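import Literature.NumberTheory.EllipticCurves.MazurTorsionStepFourAtNProofs
import Literature.NumberTheory.EllipticCurves.MazurTorsionSecondReductionProofs
import Literature.NumberTheory.EllipticCurves.GaloisActionProofs
import Literature.NumberTheory.EllipticCurves.ShafarevichGoodReductionBadPlacesProofs
import HarnessLib

/-!
# Mazur 1977, Ch. III §5: the Third reduction from Herbrand's input, and the prime-case leaf
# from the two remaining printed inputs (Step 3 at the bad primes `q ≥ N - 1`; Herbrand + class
# field theory)

Sibling proof file (theorems only, no definitions, no named facts) of `MazurTorsionProofs`,
`MazurTorsionSecondReductionProofs`, `MazurTorsionStepFourProofs` and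
`MazurTorsionStepFourAtNProofs`, for the prime-case leaf
`Literature.NumberTheory.EllipticCurves.Mazur1977_no_prime_torsion W` (B. Mazur, *Modular curves
and the Eisenstein ideal*, Publ. Math. IHÉS 47 (1977), Ch. III §5, pp. 156–160).

Mazur's proof of the prime case (pp. 156–160) runs: First reduction (to a prime
`N ∉ {2, 3, 5, 7, 13}`); the Galois structure (5.4) of `E[N]` for "`ℤ/N ⊂ E`"; Second reduction
("it suffices to prove that (5.4) splits, or equivalently `L = K`", `L = ℚ(E[N])`, `K = ℚ(ζ_N)`;
Shafarevich and the finiteness of `X₀(N)(ℚ)`); **Third reduction** (p. 158: "It suffices to show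
that `L/K` is unramified. For, suppose that `L/K` is unramified, and is a cyclic extension of
degree `N`. … By Herbrand's theorem ([20], Ch. I (2.9)), this implies that `N` divides the
numerator of `B₂ = 1/6`, which contradicts the fact that it is a prime. So, `L = K`."); and
Steps 1–4 (`E` semi-stable; `ℤ/N ⊄ (E_{/𝔽_q})⁰` — Step 3, via `X₀(N)_{/ℤ[1/2N]}` and the Eisenstein
quotient —; `L/K` unramified).  Everything except the two external inputs of the Third reduction
(Herbrand's theorem with class field theory) and of Step 3 (the Eisenstein quotient) is formalised
in the sibling files.  This file closes the circle:

* `forall_smul_geomTorsion_eq_of_herbrand_of_inertia` — **the Third reduction**: for `E/ℚ` with a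
  rational point of prime order `N`, IF (R3) every map `b : Γ_ℚ → ℤ/N` which is a homomorphism on
  `Γ_K = ker χ̄_N` transforming under conjugation by `g` through `χ̄_N(g)⁻¹`, vanishing near `1`
  and on `I_𝔓 ∩ Γ_K` for every prime `𝔓` of `\bar ℤ`, vanishes on `Γ_K` — the Galois-theoretic form
  of "an everywhere-unramified cyclic degree-`N` extension of `K`, Galois over `ℚ` with `Gal(K/ℚ)`
  acting by `χ⁻¹`, is trivial", i.e. Herbrand's theorem at `B₂` with class field theory — and IF
  every element of an inertia group fixing `μ_N` fixes `E[N]` (the conclusion of Step 4), THEN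
  `Γ_K` acts trivially on `E[N]` ("`L = K`").  The coefficient `b` is read off Mazur's (5.4)
  (`τ S₀ - S₀ = b(τ) P̄`), its `χ⁻¹`-equivariance is the tree's
  `conj_smul_sub_eq_cyclotomic_inv_smul`.
* `Mazur1977_no_prime_torsion_of_stepThree_of_herbrand` — **the leaf from the two remaining
  printed inputs**: `Mazur1977_no_prime_torsion W` holds as soon as (S3) for every elliptic curve
  `ℰ/ℚ` with a rational point of prime order `N ∉ {2, 3, 5, 7, 13}` and every place `v` of bad
  reduction with `p_v ≥ N - 1`, `p_v ≠ N`, the point lies off `ℰ₀(ℚ_v)` (Mazur's Step 3 in the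
  range not covered by the tree's `Mazur1977_not_mem_goodReductionSubgroup_at`), and (R3) as above
  holds for every such `N`.  Proof: Second reduction (`Mazur1977_no_prime_torsion_of_forall_addOrderOf`),
  Step 3 in full (tree + (S3)), Step 4 (`Mazur1977_stepFour_of_stepThree`), Third reduction (above).

* `Mazur1977_not_exists_addOrderOf_eq_of_herbrand` — **Mazur's theorem for the curves with small
  bad primes, granted only (R3)**: if (R3) holds at the prime `N ∉ {2, 3, 5, 7, 13}` and every bad
  place `v` of `E` has `p_v + 1 < N` or `p_v = N`, then `E(ℚ)` has no point of order `N` (isogenous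
  curves having the same bad places, Silverman VII.7.2, tree
  `IsIsogenous.hasGoodReductionAt_iff_of_isIsogenous`, the Eisenstein quotient is not needed).

Both hypotheses are published theorems external to the tree's vocabulary ((S3): Mazur 1977, III.§5
Step 3 with II–III (3.1); (R3): Herbrand 1932 / Mazur p. 158 with global class field theory); they
are taken as explicit hypotheses, not as named facts.

## References

* [Mazur1977] B. Mazur, *Modular curves and the Eisenstein ideal*, Publ. Math. IHÉS 47 (1977),
  Ch. III §5, pp. 156–160 (Third reduction, p. 158; Step 3, p. 159; Step 4, p. 160).
* L. C. Washington, *Introduction to Cyclotomic Fields*, 2nd ed., Thm. 6.17 (Herbrand's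
  theorem) — for the statement abbreviated as (R3); J. Herbrand, *Sur les classes des corps
  circulaires*, J. Math. Pures Appl. 11 (1932).

## Design

No definitions; `noncomputable section`; `open scoped Classical Pointwise`.  The hypotheses (S3) and
(R3) are spelled out in the tree's vocabulary (`goodReductionSubgroup` of `localMinimalModel`,
`Ideal.inertia` of primes of `absIntegers (𝓞 ℚ) ℚ`,
`Literature.NumberTheory.GaloisRepresentations.modPCyclotomicCharacterZMod`).
-/

noncomputable section

open scoped Classical Pointwise

namespace Literature.NumberTheory.EllipticCurves

open _root_.WeierstrassCurve Literature.NumberTheory.GaloisRepresentations Field NumberField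
  IsDedekindDomain Rat.HeightOneSpectrum

universe u

variable (W : WeierstrassCurve ℚ) [W.IsElliptic]

/-- **"`L/K` unramified ⇒ `L = K`" (Mazur 1977, III.§5, Third reduction, p. 158) from its
class-field-theoretic input, for the curve "`ℤ/N ⊂ E`".**  Let `E/ℚ` have a rational point `P`
of prime order `N` and write `χ̄ = χ̄_N`, `K = ℚ(ζ_N) ↔ Γ_K = ker χ̄`, `L = K(E[N])`.  Assume:
(R3) *every map `b : Γ_ℚ → ℤ/N` which is a homomorphism on `Γ_K`, transforms under conjugation by
`g ∈ Γ_ℚ` through `χ̄(g)⁻¹`, vanishes on a neighbourhood of `1` in `Γ_K` and on `I_𝔓 ∩ Γ_K` for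
every prime `𝔓` of `\bar ℤ`, vanishes on `Γ_K`* — the Galois form of "an everywhere-unramified
cyclic degree-`N` extension of `K`, Galois over `ℚ` with `Gal(K/ℚ)` acting by `χ⁻¹`, is trivial",
which is Herbrand's theorem (`N ∣ B₂`-numerator otherwise) with class field theory, Mazur p. 158 —
and (Step 4) *every element of an inertia group `I_𝔓 ≤ Γ_ℚ` fixing `μ_N` fixes `E[N]`*.  Then
`Γ_K` acts trivially on `E[N]` ("`L = K`").  Proof: with `P̄ ∈ E[N]` the geometric point of `P`
and `S₀ ∉ ⟨P̄⟩`, Mazur's (5.4) (`smul_sub_cyclotomic_smul_mem_zmultiples`) gives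
`τ S₀ - S₀ = b(τ) P̄` for `τ ∈ Γ_K`, defining `b`; it is a homomorphism on `Γ_K`, transforms by
`χ̄⁻¹` (`conj_smul_sub_eq_cyclotomic_inv_smul`), vanishes on the (open) stabiliser of `S₀` and, by
Step 4, on the inertia groups; so `b = 0` on `Γ_K`, i.e. `Γ_K` fixes `S₀` and `P̄`, which generate
`E[N]`.
[cite: Mazur1977, Ch. III §5, Third reduction, p. 158, and (5.4), p. 157] -/
theorem forall_smul_geomTorsion_eq_of_herbrand_of_inertia {N : ℕ} [Fact N.Prime]
    {P : W.toAffine.Point} (hP : addOrderOf P = N)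
    (hR3 : ∀ b : absoluteGaloisGroup ℚ → ZMod N,
      (∀ σ τ : absoluteGaloisGroup ℚ, modPCyclotomicCharacterZMod ℚ N σ = 1 →
        modPCyclotomicCharacterZMod ℚ N τ = 1 → b (σ * τ) = b σ + b τ) →
      (∀ g σ : absoluteGaloisGroup ℚ, modPCyclotomicCharacterZMod ℚ N σ = 1 →
        b (g * σ * g⁻¹) = (((modPCyclotomicCharacterZMod ℚ N g)⁻¹ : (ZMod N)ˣ) : ZMod N) * b σ) →
      (∃ U : Set (absoluteGaloisGroup ℚ), IsOpen U ∧ (1 : absoluteGaloisGroup ℚ) ∈ U ∧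
        ∀ σ ∈ U, modPCyclotomicCharacterZMod ℚ N σ = 1 → b σ = 0) →
      (∀ (v : HeightOneSpectrum (𝓞 ℚ)) (𝔓 : Ideal (absIntegers (𝓞 ℚ) ℚ)), 𝔓 ∈ v.primesAbove →
        ∀ τ ∈ 𝔓.inertia (absoluteGaloisGroup ℚ), modPCyclotomicCharacterZMod ℚ N τ = 1 → b τ = 0) →
      ∀ σ : absoluteGaloisGroup ℚ, modPCyclotomicCharacterZMod ℚ N σ = 1 → b σ = 0)
    (hunr : ∀ (v : HeightOneSpectrum (𝓞 ℚ)) (𝔓 : Ideal (absIntegers (𝓞 ℚ) ℚ)), 𝔓 ∈ v.primesAbove →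
      ∀ τ ∈ 𝔓.inertia (absoluteGaloisGroup ℚ),
        (∀ ζ : AlgebraicClosure ℚ, ζ ^ N = 1 → τ • ζ = ζ) → ∀ S : geomTorsion W N, τ • S = S)
    (τ : absoluteGaloisGroup ℚ) (hτ : modPCyclotomicCharacterZMod ℚ N τ = 1) (S : geomTorsion W N) :
    τ • S = S := by
  have hN : N.Prime := Fact.out
  haveI : NeZero N := ⟨hN.ne_zero⟩
  -- the geometric point `P̄ ≠ 0`, fixed by `Γ_ℚ`
  obtain ⟨Pb, -, hPb0, hPbfix⟩ := exists_geomTorsion_of_addOrderOf_eq W hP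
  -- a point `S₀ ∉ ⟨P̄⟩`
  have hcardZ : Nat.card (AddSubgroup.zmultiples Pb) = N := by
    rw [Nat.card_zmultiples, addOrderOf_eq_of_ne_zero W N hPb0]
  have hcardV : Nat.card (geomTorsion W N) = N ^ 2 := natCard_geomTorsion W N
  haveI : Finite (geomTorsion W N) :=
    Nat.finite_of_card_ne_zero (by rw [hcardV]; exact pow_ne_zero _ hN.ne_zero)
  obtain ⟨S₀, hS₀⟩ : ∃ S₀ : geomTorsion W N, S₀ ∉ AddSubgroup.zmultiples Pb := by
    by_contra hall
    push Not at hall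
    have htop : AddSubgroup.zmultiples Pb = ⊤ := (AddSubgroup.eq_top_iff' _).mpr hall
    have := hcardZ
    rw [htop, AddSubgroup.card_top, hcardV, sq] at this
    exact absurd (mul_right_cancel₀ hN.ne_zero (this.trans (one_mul N).symm)) hN.one_lt.ne'
  -- `τ S₀ - S₀ ∈ ⟨P̄⟩` for `τ ∈ Γ_K`: the coefficient `b`
  have hmem : ∀ σ : absoluteGaloisGroup ℚ, modPCyclotomicCharacterZMod ℚ N σ = 1 →
      σ • S₀ - S₀ ∈ AddSubgroup.zmultiples Pb := fun σ hσ ↦ by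
    have h := smul_sub_cyclotomic_smul_mem_zmultiples W N hPb0 hPbfix σ S₀
    rwa [hσ, Units.val_one, ZMod.val_one, one_smul] at h
  -- coefficients: `k • P̄` determines `k mod N`
  have hcoef : ∀ k k' : ℤ, k • Pb = k' • Pb → (k : ZMod N) = k' := by
    intro k k' h
    rw [ZMod.intCast_eq_intCast_iff, Int.modEq_iff_dvd]
    have h0 : (k' - k) • Pb = 0 := by rw [sub_zsmul, h]; abel
    have := addOrderOf_dvd_iff_zsmul_eq_zero.mpr h0
    rwa [addOrderOf_eq_of_ne_zero W N hPb0] at this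
  set b : absoluteGaloisGroup ℚ → ZMod N := fun σ ↦
    if h : modPCyclotomicCharacterZMod ℚ N σ = 1 then
      ((AddSubgroup.mem_zmultiples_iff.mp (hmem σ h)).choose : ZMod N) else 0 with hbdef
  have hb : ∀ σ (hσ : modPCyclotomicCharacterZMod ℚ N σ = 1) (k : ℤ),
      k • Pb = σ • S₀ - S₀ → b σ = k := by
    intro σ hσ k hk
    rw [hbdef]
    simp only [dif_pos hσ]
    exact hcoef _ _ ((AddSubgroup.mem_zmultiples_iff.mp (hmem σ hσ)).choose_spec.trans hk.symm)
  have hbspec : ∀ σ, modPCyclotomicCharacterZMod ℚ N σ = 1 →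
      ((b σ).val : ℤ) • Pb = σ • S₀ - S₀ := by
    intro σ hσ
    obtain ⟨k, hk⟩ := AddSubgroup.mem_zmultiples_iff.mp (hmem σ hσ)
    rw [hb σ hσ k hk, ← hk]
    -- `(k : ZMod N).val ≡ k (mod N)`
    have hmod : (((k : ZMod N).val : ℤ) : ZMod N) = (k : ZMod N) := by
      rw [Int.cast_natCast, ZMod.natCast_zmod_val]
    have hdvd : (N : ℤ) ∣ ((k : ZMod N).val : ℤ) - k := by
      rw [← ZMod.intCast_eq_intCast_iff_dvd_sub] ; exact hmod.symm
    obtain ⟨m, hm⟩ := hdvd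
    have hNPb : (N : ℤ) • Pb = 0 := by
      rw [natCast_zsmul]
      have h := addOrderOf_nsmul_eq_zero Pb
      rwa [addOrderOf_eq_of_ne_zero W N hPb0] at h
    calc (((k : ZMod N).val : ℤ)) • Pb = (k + N * m) • Pb := by rw [← hm]; congr 1; ring
      _ = k • Pb := by rw [add_zsmul, mul_comm, mul_zsmul, hNPb, zsmul_zero, add_zero]
  /- the four hypotheses of (R3) for `b` -/
  -- (a) homomorphism on `Γ_K`
  have hhom : ∀ σ τ : absoluteGaloisGroup ℚ, modPCyclotomicCharacterZMod ℚ N σ = 1 →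
      modPCyclotomicCharacterZMod ℚ N τ = 1 → b (σ * τ) = b σ + b τ := by
    intro σ τ' hσ hτ'
    have hστ : modPCyclotomicCharacterZMod ℚ N (σ * τ') = 1 := by rw [map_mul, hσ, hτ', mul_one]
    have h1 := hbspec σ hσ
    have h2 := hbspec τ' hτ'
    -- `στ S₀ - S₀ = σ (τ S₀ - S₀) + (σ S₀ - S₀)` and `σ` fixes `⟨P̄⟩`
    have key : (((b σ).val : ℤ) + ((b τ').val : ℤ)) • Pb = (σ * τ') • S₀ - S₀ := by
      rw [add_zsmul, h1, mul_smul]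
      have h3 : σ • (τ' • S₀ - S₀) = ((b τ').val : ℤ) • Pb := by
        rw [← h2, ← DistribMulAction.toAddMonoidHom_apply, map_zsmul,
          DistribMulAction.toAddMonoidHom_apply, hPbfix]
      rw [← h3, smul_sub]
      abel
    rw [hb _ hστ _ key, Int.cast_add, Int.cast_natCast, Int.cast_natCast, ZMod.natCast_zmod_val,
      ZMod.natCast_zmod_val]
  -- (b) `χ̄⁻¹`-equivariance under conjugation
  have hconj : ∀ g σ : absoluteGaloisGroup ℚ, modPCyclotomicCharacterZMod ℚ N σ = 1 →
      b (g * σ * g⁻¹) = (((modPCyclotomicCharacterZMod ℚ N g)⁻¹ : (ZMod N)ˣ) : ZMod N) * b σ := by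
    intro g σ hσ
    have hgσ : modPCyclotomicCharacterZMod ℚ N (g * σ * g⁻¹) = 1 := by
      rw [map_mul, map_mul, hσ, mul_one, map_inv, mul_inv_cancel]
    have h1 := conj_smul_sub_eq_cyclotomic_inv_smul W N hPb0 hPbfix hσ g S₀
    have h2 := hbspec σ hσ
    have key : (((((modPCyclotomicCharacterZMod ℚ N g)⁻¹ : (ZMod N)ˣ) : ZMod N).val : ℤ) *
        ((b σ).val : ℤ)) • Pb = (g * σ * g⁻¹) • S₀ - S₀ := by
      rw [h1, ← h2, mul_zsmul, natCast_zsmul]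
    rw [hb _ hgσ _ key, Int.cast_mul, Int.cast_natCast, Int.cast_natCast, ZMod.natCast_zmod_val,
      ZMod.natCast_zmod_val]
  -- (c) vanishing near `1`: on the stabiliser of `S₀`
  have hopen : ∃ U : Set (absoluteGaloisGroup ℚ), IsOpen U ∧ (1 : absoluteGaloisGroup ℚ) ∈ U ∧
      ∀ σ ∈ U, modPCyclotomicCharacterZMod ℚ N σ = 1 → b σ = 0 := by
    refine ⟨(MulAction.stabilizer (absoluteGaloisGroup ℚ) (S₀ : geomPoints W) : Set _),
      isOpen_stabilizer_point_holds W (S₀ : geomPoints W), one_mem _, fun σ hσ hχ ↦ ?_⟩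
    have hfix : σ • S₀ = S₀ := Subtype.ext (MulAction.mem_stabilizer_iff.mp hσ)
    have := hb σ hχ 0 (by rw [zero_zsmul, hfix, sub_self])
    rw [this, Int.cast_zero]
  -- (d) vanishing on the inertia groups (Step 4)
  have hinert : ∀ (v : HeightOneSpectrum (𝓞 ℚ)) (𝔓 : Ideal (absIntegers (𝓞 ℚ) ℚ)),
      𝔓 ∈ v.primesAbove → ∀ τ ∈ 𝔓.inertia (absoluteGaloisGroup ℚ),
        modPCyclotomicCharacterZMod ℚ N τ = 1 → b τ = 0 := by
    intro v 𝔓 h𝔓 τ' hτ'I hχ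
    have hζ : ∀ ζ : AlgebraicClosure ℚ, ζ ^ N = 1 → τ' • ζ = ζ := fun ζ hζ ↦ by
      have h := modPCyclotomicCharacterZMod_spec ℚ N τ' ζ hζ
      rwa [hχ, Units.val_one, ZMod.val_one, pow_one] at h
    have hfix := hunr v 𝔓 h𝔓 τ' hτ'I hζ S₀
    have := hb τ' hχ 0 (by rw [zero_zsmul, hfix, sub_self])
    rw [this, Int.cast_zero]
  /- conclusion: `b = 0` on `Γ_K`, so `τ` fixes `S₀`; with `P̄` this gives everything -/
  have hbτ : b τ = 0 := hR3 b hhom hconj hopen hinert τ hτ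
  have hτS₀ : τ • S₀ = S₀ := by
    have h := hbspec τ hτ
    rw [hbτ, ZMod.val_zero, Nat.cast_zero, zero_zsmul] at h
    exact (sub_eq_zero.mp h.symm)
  have hτPb : τ • Pb = Pb := hPbfix τ
  -- the fixed subgroup of `τ` contains `⟨P̄⟩` and `S₀`, hence is everything
  set Fix : AddSubgroup (geomTorsion W N) :=
    ((DistribSMul.toAddMonoidHom (geomTorsion W N) τ) - AddMonoidHom.id _).ker with hFixdef
  have hmemFix : ∀ R, R ∈ Fix ↔ τ • R = R := fun R ↦ by
    rw [hFixdef, AddMonoidHom.mem_ker, AddMonoidHom.sub_apply, AddMonoidHom.id_apply,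
      DistribSMul.toAddMonoidHom_apply, sub_eq_zero]
  have hZle : AddSubgroup.zmultiples Pb ≤ Fix :=
    AddSubgroup.zmultiples_le_of_mem ((hmemFix _).mpr hτPb)
  have hS₀Fix : S₀ ∈ Fix := (hmemFix _).mpr hτS₀
  haveI : Finite (AddSubgroup.zmultiples Pb) := Nat.finite_of_card_ne_zero (by rw [hcardZ]; exact hN.ne_zero)
  have hdvd : Nat.card Fix ∣ N ^ 2 := by
    have h := AddSubgroup.card_dvd_of_le (le_top : Fix ≤ ⊤)
    rwa [AddSubgroup.card_top, hcardV] at h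
  obtain ⟨i, hi, hcardFix⟩ := (Nat.dvd_prime_pow hN).mp hdvd
  have hFixtop : Fix = ⊤ := by
    have hi2 : i = 2 := by
      by_contra hne
      have hle : Nat.card Fix ≤ Nat.card (AddSubgroup.zmultiples Pb) := by
        rw [hcardFix, hcardZ]
        calc N ^ i ≤ N ^ 1 := Nat.pow_le_pow_right hN.pos (by omega)
          _ = N := pow_one N
      have heq := AddSubgroup.eq_of_le_of_card_ge hZle hle
      exact hS₀ (heq ▸ hS₀Fix)
    apply AddSubgroup.eq_top_of_card_eq
    rw [hcardFix, hi2, hcardV]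
  have : S ∈ Fix := by rw [hFixtop]; exact AddSubgroup.mem_top S
  exact (hmemFix _).mp this


omit [W.IsElliptic] in
/-- **The prime-case leaf from the two remaining printed inputs.**  `Mazur1977_no_prime_torsion W`
— no rational point of prime order `N ∉ {2, 3, 5, 7, 13}` on the elliptic curve `E = W/ℚ` — holds
as soon as:
(S3) for every elliptic curve `ℰ/ℚ` with a rational point `P` of prime order
`N ∉ {2, 3, 5, 7, 13}` and every place `v` of bad reduction with `p_v ≠ N` and `N ≤ p_v + 1`, the
image of `P` on the minimal model `ℰ.localMinimalModel v` lies off `ℰ₀(ℚ_v)` — Mazur's Step 3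
(p. 159, via `X₀(N)_{/ℤ[1/2N]}`, the cusps and the Eisenstein quotient with `J̃(ℚ)` finite) in the
range of primes not covered by the tree's `Mazur1977_not_mem_goodReductionSubgroup_at`; and
(R3) for every such `N`, the Galois-theoretic Herbrand statement of
`forall_smul_geomTorsion_eq_of_herbrand_of_inertia` (no non-trivial everywhere-unramified
`χ⁻¹`-equivariant homomorphism `Γ_{ℚ(ζ_N)} → ℤ/N`; Herbrand's theorem at `B₂ = 1/6` with class
field theory, Mazur p. 158).
PROOF (the printed architecture, every other step a theorem of the tree): by the Second reduction
(`Mazur1977_no_prime_torsion_of_forall_addOrderOf`) it suffices that `Γ_K` act trivially on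
`ℰ[N]` for every `ℰ` isogenous to `E` with a rational point of order `N`; Step 3 holds at every
bad `v ∤ N` (tree for `p_v + 1 < N`, (S3) otherwise); Step 4 (`Mazur1977_stepFour_of_stepThree`)
makes every inertia element fixing `μ_N` act trivially on `ℰ[N]`; and the Third reduction
(`forall_smul_geomTorsion_eq_of_herbrand_of_inertia`, from (R3)) gives `L = K`.
[cite: Mazur1977, Ch. III §5, pp. 156–160] -/
theorem Mazur1977_no_prime_torsion_of_stepThree_of_herbrand
    (hS3 : ∀ (E : WeierstrassCurve ℚ) [E.IsElliptic] (N : ℕ) [Fact N.Prime],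
      N ∉ ({2, 3, 5, 7, 13} : Finset ℕ) → ∀ {P : E.toAffine.Point}, addOrderOf P = N →
        ∀ v : HeightOneSpectrum (𝓞 ℚ), ¬ E.HasGoodReductionAt v → (primesEquiv v : ℕ) ≠ N →
          N ≤ (primesEquiv v : ℕ) + 1 →
            VariableChange.pointEquiv (E.baseChange (v.adicCompletion ℚ))
                ((E.baseChange (v.adicCompletion ℚ)).exists_isMinimal
                  (v.adicCompletionIntegers ℚ)).choose
                (Affine.Point.map (W' := E.toAffine) (S := ℚ)
                  (Algebra.ofId ℚ (v.adicCompletion ℚ)) P) ∉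
              (E.localMinimalModel v).goodReductionSubgroup (v.adicCompletionIntegers ℚ))
    (hR3 : ∀ (N : ℕ) [Fact N.Prime], N ∉ ({2, 3, 5, 7, 13} : Finset ℕ) →
      ∀ b : absoluteGaloisGroup ℚ → ZMod N,
        (∀ σ τ : absoluteGaloisGroup ℚ, modPCyclotomicCharacterZMod ℚ N σ = 1 →
          modPCyclotomicCharacterZMod ℚ N τ = 1 → b (σ * τ) = b σ + b τ) →
        (∀ g σ : absoluteGaloisGroup ℚ, modPCyclotomicCharacterZMod ℚ N σ = 1 →
          b (g * σ * g⁻¹) =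
            (((modPCyclotomicCharacterZMod ℚ N g)⁻¹ : (ZMod N)ˣ) : ZMod N) * b σ) →
        (∃ U : Set (absoluteGaloisGroup ℚ), IsOpen U ∧ (1 : absoluteGaloisGroup ℚ) ∈ U ∧
          ∀ σ ∈ U, modPCyclotomicCharacterZMod ℚ N σ = 1 → b σ = 0) →
        (∀ (v : HeightOneSpectrum (𝓞 ℚ)) (𝔓 : Ideal (absIntegers (𝓞 ℚ) ℚ)), 𝔓 ∈ v.primesAbove →
          ∀ τ ∈ 𝔓.inertia (absoluteGaloisGroup ℚ), modPCyclotomicCharacterZMod ℚ N τ = 1 →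
            b τ = 0) →
        ∀ σ : absoluteGaloisGroup ℚ, modPCyclotomicCharacterZMod ℚ N σ = 1 → b σ = 0) :
    Mazur1977_no_prime_torsion W := by
  refine Mazur1977_no_prime_torsion_of_forall_addOrderOf W fun N _ hNS E _ _ hex τ hτ S ↦ ?_
  obtain ⟨P, hP⟩ := hex
  have hN : N.Prime := Fact.out
  -- Step 3 at every bad place `v ∤ N`: the tree for `p_v + 1 < N`, (S3) otherwise
  have h3 : ∀ v : HeightOneSpectrum (𝓞 ℚ), ¬ E.HasGoodReductionAt v → (primesEquiv v : ℕ) ≠ N →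
      VariableChange.pointEquiv (E.baseChange (v.adicCompletion ℚ))
          ((E.baseChange (v.adicCompletion ℚ)).exists_isMinimal (v.adicCompletionIntegers ℚ)).choose
          (Affine.Point.map (W' := E.toAffine) (S := ℚ) (Algebra.ofId ℚ (v.adicCompletion ℚ)) P) ∉
        (E.localMinimalModel v).goodReductionSubgroup (v.adicCompletionIntegers ℚ) := by
    intro v hbad hvN
    by_cases hlt : (primesEquiv v : ℕ) + 1 < N
    · exact (Mazur1977_not_mem_goodReductionSubgroup_at E hN hNS hP v hlt hbad).1
    · exact hS3 E N hNS hP v hbad hvN (by omega)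
  -- Step 4: inertia elements fixing `μ_N` act trivially on `E[N]`
  have hunr : ∀ (v : HeightOneSpectrum (𝓞 ℚ)) (𝔓 : Ideal (absIntegers (𝓞 ℚ) ℚ)),
      𝔓 ∈ v.primesAbove → ∀ τ' ∈ 𝔓.inertia (absoluteGaloisGroup ℚ),
        (∀ ζ : AlgebraicClosure ℚ, ζ ^ N = 1 → τ' • ζ = ζ) → ∀ S' : geomTorsion E N, τ' • S' = S' := by
    intro v 𝔓 h𝔓 τ' hτ'I hζ S'
    have hS' : N • (S' : geomPoints E) = 0 := by
      have h := (Submodule.mem_torsionBy_iff (N : ℤ) S'.1).mp S'.2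
      rwa [natCast_zsmul] at h
    exact Subtype.ext (by
      rw [AddSubgroup.torsionBy.coe_smul]
      exact Mazur1977_stepFour_of_stepThree E hNS hP h3 v h𝔓 hτ'I hζ hS')
  -- Third reduction
  exact forall_smul_geomTorsion_eq_of_herbrand_of_inertia E hP (hR3 N hNS) hunr τ hτ S

/-- **Conditionally on Herbrand's input alone: no rational point of order `N` when the bad primes
are small or equal to `N`.**  Let `N ∉ {2, 3, 5, 7, 13}` be a prime for which (R3) (the Galois
form of Herbrand's theorem at `B₂` with class field theory, as in
`forall_smul_geomTorsion_eq_of_herbrand_of_inertia`) holds, and let `E/ℚ` be an elliptic curve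
all of whose places `v` of bad reduction satisfy `p_v + 1 < N` or `p_v = N`.  Then `E(ℚ)` has no
point of order `N`.  PROOF: every `ℰ` isogenous to `E` has the same bad places (Silverman
VII.7.2, tree `IsIsogenous.hasGoodReductionAt_iff_of_isIsogenous`), so Step 3 for `ℰ` at the bad
`v ∤ N` is the tree's `Mazur1977_not_mem_goodReductionSubgroup_at`; Step 4
(`Mazur1977_stepFour_of_stepThree`) and the Third reduction (from (R3)) give `L = K` for every such
`ℰ` carrying a rational `N`-point, and the Second reduction
(`Mazur1977_secondReduction_of_forall_smul_eq`) concludes.  (Mazur's theorem for these curves,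
granted only Herbrand–class-field theory; the Eisenstein quotient is needed for the others.)
[cite: Mazur1977, Ch. III §5, pp. 156–160] -/
theorem Mazur1977_not_exists_addOrderOf_eq_of_herbrand {N : ℕ} [Fact N.Prime]
    (hNS : N ∉ ({2, 3, 5, 7, 13} : Finset ℕ))
    (hR3 : ∀ b : absoluteGaloisGroup ℚ → ZMod N,
      (∀ σ τ : absoluteGaloisGroup ℚ, modPCyclotomicCharacterZMod ℚ N σ = 1 →
        modPCyclotomicCharacterZMod ℚ N τ = 1 → b (σ * τ) = b σ + b τ) →
      (∀ g σ : absoluteGaloisGroup ℚ, modPCyclotomicCharacterZMod ℚ N σ = 1 →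
        b (g * σ * g⁻¹) = (((modPCyclotomicCharacterZMod ℚ N g)⁻¹ : (ZMod N)ˣ) : ZMod N) * b σ) →
      (∃ U : Set (absoluteGaloisGroup ℚ), IsOpen U ∧ (1 : absoluteGaloisGroup ℚ) ∈ U ∧
        ∀ σ ∈ U, modPCyclotomicCharacterZMod ℚ N σ = 1 → b σ = 0) →
      (∀ (v : HeightOneSpectrum (𝓞 ℚ)) (𝔓 : Ideal (absIntegers (𝓞 ℚ) ℚ)), 𝔓 ∈ v.primesAbove →
        ∀ τ ∈ 𝔓.inertia (absoluteGaloisGroup ℚ), modPCyclotomicCharacterZMod ℚ N τ = 1 → b τ = 0) →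
      ∀ σ : absoluteGaloisGroup ℚ, modPCyclotomicCharacterZMod ℚ N σ = 1 → b σ = 0)
    (hbad : ∀ v : HeightOneSpectrum (𝓞 ℚ), ¬ W.HasGoodReductionAt v →
      (primesEquiv v : ℕ) + 1 < N ∨ (primesEquiv v : ℕ) = N) :
    ¬ ∃ P : W.toAffine.Point, addOrderOf P = N := by
  rintro ⟨P, hP⟩
  have hN : N.Prime := Fact.out
  refine Mazur1977_secondReduction_of_forall_smul_eq W hP fun E _ hiso Q hQ0 hQ τ hτ S ↦ ?_
  obtain ⟨PE, hPE, -⟩ := exists_addOrderOf_eq_of_smul_eq E hQ0 hQ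
  -- the bad places of `ℰ` are those of `E`
  have hbadE : ∀ v : HeightOneSpectrum (𝓞 ℚ), ¬ E.HasGoodReductionAt v →
      (primesEquiv v : ℕ) + 1 < N ∨ (primesEquiv v : ℕ) = N := fun v hv ↦
    hbad v (fun h ↦ hv ((hiso.hasGoodReductionAt_iff_of_isIsogenous v).mp h))
  -- Step 3 for `ℰ` at the bad `v ∤ N` (all with `p_v + 1 < N`)
  have h3 : ∀ v : HeightOneSpectrum (𝓞 ℚ), ¬ E.HasGoodReductionAt v → (primesEquiv v : ℕ) ≠ N →
      VariableChange.pointEquiv (E.baseChange (v.adicCompletion ℚ))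
          ((E.baseChange (v.adicCompletion ℚ)).exists_isMinimal (v.adicCompletionIntegers ℚ)).choose
          (Affine.Point.map (W' := E.toAffine) (S := ℚ) (Algebra.ofId ℚ (v.adicCompletion ℚ)) PE) ∉
        (E.localMinimalModel v).goodReductionSubgroup (v.adicCompletionIntegers ℚ) := by
    intro v hv hvN
    have hlt : (primesEquiv v : ℕ) + 1 < N := (hbadE v hv).resolve_right hvN
    exact (Mazur1977_not_mem_goodReductionSubgroup_at E hN hNS hPE v hlt hv).1
  -- Step 4 and the Third reduction
  have hunr : ∀ (v : HeightOneSpectrum (𝓞 ℚ)) (𝔓 : Ideal (absIntegers (𝓞 ℚ) ℚ)),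
      𝔓 ∈ v.primesAbove → ∀ τ' ∈ 𝔓.inertia (absoluteGaloisGroup ℚ),
        (∀ ζ : AlgebraicClosure ℚ, ζ ^ N = 1 → τ' • ζ = ζ) → ∀ S' : geomTorsion E N, τ' • S' = S' := by
    intro v 𝔓 h𝔓 τ' hτ'I hζ S'
    have hS' : N • (S' : geomPoints E) = 0 := by
      have h := (Submodule.mem_torsionBy_iff (N : ℤ) S'.1).mp S'.2
      rwa [natCast_zsmul] at h
    exact Subtype.ext (by
      rw [AddSubgroup.torsionBy.coe_smul]
      exact Mazur1977_stepFour_of_stepThree E hNS hPE h3 v h𝔓 hτ'I hζ hS')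
  exact forall_smul_geomTorsion_eq_of_herbrand_of_inertia E hPE hR3 hunr τ hτ S

end Literature.NumberTheory.EllipticCurves

end
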